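import Literature.AnabelianGeometry.AbsoluteAnabelian.AbsTopIII.FrobeniusPictureMLFCompatibility
import Literature.AnabelianGeometry.AbsoluteAnabelian.DiagramComap
import Literature.AnabelianGeometry.AbsoluteAnabelian.DiagramLifts
import Literature.AnabelianGeometry.AbsoluteAnabelian.AbsTopIII.FrobeniusPictureMLFShift

/-!
# [AbsTopIII] Cor 3.6: the presentations `𝒟_{≤3}`, `𝒟_{≤n} ∪ {core}`, `𝒟_{≤3} ↪ 𝒟_An` have the path
# functors of `𝒟` (transport lemmas for the literal compatibility statements)

S. Mochizuki, *Topics in Absolute Anabelian Geometry III*, Cor. 3.6 pp. 78–80, Def. 3.5 (i)–(ii)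
pp. 74–75 of the kurims manuscript (`paper:url-5493eb38cbb7`; bib key `MochizukiAbsTopIII2015`).
Proof-only companion of `FrobeniusPictureMLFCompatibility.lean` (seat abc-iut-L4-t5): along each of
the graph embeddings used there (`embLog : 𝒟_{≤3} ↪ 𝒟`, `embCore4/5/6 : 𝒟_{≤n-1} ∪ {core} ↪ 𝒟`,
`embLogTele : 𝒟_{≤3} ↪ 𝒟_An`) the path functors `𝒟'_{[γ]}` of the presentation and `𝒟_{F[γ]}` of the
target AGREE (heterogeneously; by construction of `extend` / `restrict` and of the embeddings, exactly
as `pathFunctor_telecoreInclusion`).  These are the "evident" identifications behind print's use of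
one notion of compatibility (Def. 3.5 (ii)) for families living on different sub-diagrams of `𝒟`,
and the lemmas a discharge of `LogObsCompatCoresStmt` / `LogObsCompatTelecoreStmt` transports along.
Second half: each presentation IS the pulled-back diagram `F^*𝒟` (`sub3_eq_comapAlong`, `core4/5/6Diagram_eq_comapAlong`,
`sub3_eq_comapAlong_tele`; via `DiagramOfCategories.eq_comapAlong` of `DiagramComap.lean`), so every
family `K` on `𝒟` (resp. on `𝒟_An`) PULLS BACK to a family on the presentation (`pullLog K`,
`pullCore4/5/6 K`, `pullLogTele K`) that is compatible with `K` along the embedding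
(`pullLog_compatibleAlong`, …) and has the expected boundary set (`pullLog_E_iff`, …); the pairs ending
at a sink vertex form a sub-family (`HomotopyFamily.endingAt`).  Consequently the literal (iii)-cores
statement reduces to properties of ONE family on `𝒟`: `realisesCoresAndLogObs_of_pull`,
`logObsCompatCoresStmt_of_pull` (the discharge target: a family on `𝒟` whose pullback to `𝒟_{≤3}` is the
`𝔖_log` family and whose pairs into the row-4/5/6 vertices are cores — cf. `IotaOverGaloisStmt`).
Pure bookkeeping; no claim of the paper is asserted; nothing here bears on [IUTchIII] Cor. 3.12.
-/

namespace Literature.AnabelianGeometry.AbsoluteAnabelian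

open _root_.CategoryTheory _root_.Quiver

universe u

namespace DiagramOfCategories

/-- The pairs of a boundary set ENDING AT a vertex `ω` without outgoing edges form a saturated subset
(bookkeeping for "every boundary set path has terminal vertex `v_𝒮`", Def. 3.5 (iii) (c)).
[cite: MochizukiAbsTopIII2015, Definition 3.5 (iii) p.75] -/
theorem isSaturated_endingAt {V' : Type*} [Quiver V'] {E : ∀ ⦃a b : V'⦄, Path a b → Path a b → Prop}
    (hE : IsSaturated E) (ω : V') (hout : ∀ b : V', IsEmpty (ω ⟶ b)) :
    IsSaturated (fun ⦃_ b⦄ p q => b = ω ∧ E p q) where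
  refl_left := fun ⦃_ _ _ _⦄ h => ⟨h.1, hE.refl_left h.2⟩
  refl_right := fun ⦃_ _ _ _⦄ h => ⟨h.1, hE.refl_right h.2⟩
  trans := fun ⦃_ _ _ _ _⦄ h₁ h₂ => ⟨h₁.1, hE.trans h₁.2 h₂.2⟩
  precomp := fun ⦃_ _ _ _ _⦄ h r => ⟨h.1, hE.precomp h.2 r⟩
  postcomp := fun ⦃_ _ _ _ _⦄ h r => by
    obtain ⟨rfl, h⟩ := h
    exact ⟨eq_of_path_of_isEmpty_hom hout r, hE.postcomp h r⟩

/-- **The part of a family of homotopies ending at a sink vertex `ω`** (same homotopies; boundary set cut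
down to the pairs with terminal vertex `ω` — the shape required of an observable / core, Def. 3.5 (iii)).
[cite: MochizukiAbsTopIII2015, Definition 3.5 (iii) p.75] -/
def HomotopyFamily.endingAt {V' : Type*} [Quiver V'] {D' : DiagramOfCategories V'}
    (H : D'.HomotopyFamily) (ω : V') (hout : ∀ b : V', IsEmpty (ω ⟶ b)) : D'.HomotopyFamily :=
  H.restrictBoundary (fun ⦃_ b⦄ p q => b = ω ∧ H.E p q) (isSaturated_endingAt H.isSaturated ω hout)
    (fun ⦃_ _ _ _⦄ h => h.2)

/-- Its boundary pairs end at `ω`. [cite: MochizukiAbsTopIII2015, Definition 3.5 (iii) p.75] -/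
theorem HomotopyFamily.endingAt_terminal {V' : Type*} [Quiver V'] {D' : DiagramOfCategories V'}
    (H : D'.HomotopyFamily) (ω : V') (hout : ∀ b : V', IsEmpty (ω ⟶ b))
    ⦃a b : V'⦄ ⦃p q : Path a b⦄ (h : (H.endingAt ω hout).E p q) : b = ω := h.1

/-- It is compatible along `F` with whatever `H` is. [cite: MochizukiAbsTopIII2015, Definition 3.5 (ii) p.75] -/
theorem HomotopyFamily.endingAt_compatibleAlong {V' : Type*} [Quiver V']
    {D' : DiagramOfCategories V'} {V : Type*} [Quiver V] {D : DiagramOfCategories V}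
    (F : V' ⥤q V) (H : D'.HomotopyFamily) (K : D.HomotopyFamily) (hK : H.CompatibleAlong F K) (ω : V')
    (hout : ∀ b : V', IsEmpty (ω ⟶ b)) : (H.endingAt ω hout).CompatibleAlong F K :=
  fun _ _ p q h => hK p q h.2

end DiagramOfCategories

namespace LogFrobeniusData

open DiagramOfCategories

variable (Δ : LogFrobeniusData.{u})

/-- Along `embLog : 𝒟_{≤3} ↪ 𝒟` the path functors of the presentation `sub3 = 𝒟_{≤2} ∪ {𝒩}` and of `𝒟`
agree. [cite: MochizukiAbsTopIII2015, Corollary 3.6 (iii) p.80] -/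
theorem heq_pathFunctor_embLog :
    ∀ {a b : logObsShape.{u}.Vertex} (p : Path a b),
      HEq (Δ.sub3.pathFunctor p) (Δ.diagram.pathFunctor (embLog.mapPath p)) := by
  intro a b p
  induction p with
  | nil =>
    rw [Prefunctor.mapPath_nil, pathFunctor_nil, pathFunctor_nil]
    cases a <;> rfl
  | cons p e ih =>
    rename_i c b
    rw [Prefunctor.mapPath_cons, pathFunctor_cons, pathFunctor_cons]
    revert ih e
    rcases a with _ | _ <;> rcases c with ⟨_ | _ | _ | _ | _ | _, _⟩ | _ <;> rcases b with _ | _ <;>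
      intro e ih <;>
      first
        | exact (PEmpty.elim e)
        | (rw [eq_of_heq ih]; rfl)

/-- Along `embCore4 : 𝒟_{≤3} ∪ {ℰ} ↪ 𝒟` the path functors of the core presentation `core4Diagram` and
of `𝒟` agree. [cite: MochizukiAbsTopIII2015, Corollary 3.6 (i) p.79] -/
theorem heq_pathFunctor_embCore4 :
    ∀ {a b : coreShape4.{u}.Vertex} (p : Path a b),
      HEq (Δ.core4Diagram.pathFunctor p) (Δ.diagram.pathFunctor (embCore4.mapPath p)) := by
  intro a b p
  induction p with
  | nil =>
    rw [Prefunctor.mapPath_nil, pathFunctor_nil, pathFunctor_nil]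
    cases a <;> rfl
  | cons p e ih =>
    rename_i c b
    rw [Prefunctor.mapPath_cons, pathFunctor_cons, pathFunctor_cons]
    revert ih e
    rcases a with _ | _ <;> rcases c with ⟨_ | _ | _ | _ | _ | _, _⟩ | _ <;> rcases b with _ | _ <;>
      intro e ih <;>
      first
        | exact (PEmpty.elim e)
        | (rw [eq_of_heq ih]; rfl)

/-- Along `embCore5 : 𝒟_{≤4} ∪ {Anab} ↪ 𝒟` the path functors of `core5Diagram` and of `𝒟` agree.
[cite: MochizukiAbsTopIII2015, Corollary 3.6 (i) p.79] -/
theorem heq_pathFunctor_embCore5 :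
    ∀ {a b : coreShape5.{u}.Vertex} (p : Path a b),
      HEq (Δ.core5Diagram.pathFunctor p) (Δ.diagram.pathFunctor (embCore5.mapPath p)) := by
  intro a b p
  induction p with
  | nil =>
    rw [Prefunctor.mapPath_nil, pathFunctor_nil, pathFunctor_nil]
    cases a <;> rfl
  | cons p e ih =>
    rename_i c b
    rw [Prefunctor.mapPath_cons, pathFunctor_cons, pathFunctor_cons]
    revert ih e
    rcases a with _ | _ <;> rcases c with ⟨_ | _ | _ | _ | _ | _, _⟩ | _ <;> rcases b with _ | _ <;>
      intro e ih <;>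
      first
        | exact (PEmpty.elim e)
        | (rw [eq_of_heq ih]; rfl)

/-- Along `embCore6 : 𝒟_{≤5} ∪ {ℰ} ↪ 𝒟` the path functors of `core6Diagram` and of `𝒟` agree.
[cite: MochizukiAbsTopIII2015, Corollary 3.6 (i) p.79] -/
theorem heq_pathFunctor_embCore6 :
    ∀ {a b : coreShape6.{u}.Vertex} (p : Path a b),
      HEq (Δ.core6Diagram.pathFunctor p) (Δ.diagram.pathFunctor (embCore6.mapPath p)) := by
  intro a b p
  induction p with
  | nil =>
    rw [Prefunctor.mapPath_nil, pathFunctor_nil, pathFunctor_nil]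
    cases a <;> rfl
  | cons p e ih =>
    rename_i c b
    rw [Prefunctor.mapPath_cons, pathFunctor_cons, pathFunctor_cons]
    revert ih e
    rcases a with _ | _ <;> rcases c with ⟨_ | _ | _ | _ | _ | _, _⟩ | _ <;> rcases b with _ | _ <;>
      intro e ih <;>
      first
        | exact (PEmpty.elim e)
        | (rw [eq_of_heq ih]; rfl)

/-- Along `embLogTele : 𝒟_{≤3} ↪ 𝒟_An` the path functors of `sub3` and of the telecore diagram
`teleDiagram J telMap` agree (for every family of telecore edges and functors on them).
[cite: MochizukiAbsTopIII2015, Corollary 3.6 (iii) p.80] -/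
theorem heq_pathFunctor_embLogTele (J : SubVertex {a : LFVertex | a.row ≤ 4} → Type u)
    (telMap : ∀ {a}, J a → (Δ.A ⥤ (Δ.sub 4).obj a)) :
    ∀ {a b : logObsShape.{u}.Vertex} (p : Path a b),
      HEq (Δ.sub3.pathFunctor p) ((Δ.teleDiagram J telMap).pathFunctor ((embLogTele J).mapPath p)) := by
  intro a b p
  induction p with
  | nil =>
    rw [Prefunctor.mapPath_nil, pathFunctor_nil, pathFunctor_nil]
    cases a <;> rfl
  | cons p e ih =>
    rename_i c b
    rw [Prefunctor.mapPath_cons, pathFunctor_cons, pathFunctor_cons]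
    revert ih e
    rcases a with _ | _ <;> rcases c with ⟨_ | _ | _ | _ | _ | _, _⟩ | _ <;> rcases b with _ | _ <;>
      intro e ih <;>
      first
        | exact (PEmpty.elim e)
        | (rw [eq_of_heq ih]; rfl)

/-! ### The presentations ARE the pulled-back diagrams; pulled-back families -/

/-- `𝒟_{≤3}` presented as `𝒟_{≤2} ∪ {𝒩}` (`sub3`) IS the sub-diagram `embLog^*𝒟` of `𝒟`.
[cite: MochizukiAbsTopIII2015, Corollary 3.6 (iii) p.80] -/
theorem sub3_eq_comapAlong : Δ.sub3 = Δ.diagram.comapAlong embLog :=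
  Δ.diagram.eq_comapAlong embLog (fun a => by rcases a with _ | _ <;> rfl)
    (fun a => by rcases a with _ | _ <;> exact HEq.rfl)
    (fun e => by
      rename_i a b
      revert e
      rcases a with ⟨_ | _ | _ | _ | _ | _, _⟩ | _ <;> rcases b with _ | _ <;> intro e <;>
        first | exact (PEmpty.elim e) | exact HEq.rfl)

/-- `𝒟_{≤3} ∪ {ℰ}` (`core4Diagram`) IS `embCore4^*𝒟`. [cite: MochizukiAbsTopIII2015, Corollary 3.6 (i) p.79] -/
theorem core4Diagram_eq_comapAlong : Δ.core4Diagram = Δ.diagram.comapAlong embCore4 :=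
  Δ.diagram.eq_comapAlong embCore4 (fun a => by rcases a with _ | _ <;> rfl)
    (fun a => by rcases a with _ | _ <;> exact HEq.rfl)
    (fun e => by
      rename_i a b
      revert e
      rcases a with ⟨_ | _ | _ | _ | _ | _, _⟩ | _ <;> rcases b with _ | _ <;> intro e <;>
        first | exact (PEmpty.elim e) | exact HEq.rfl)

/-- `𝒟_{≤4} ∪ {Anab}` (`core5Diagram`) IS `embCore5^*𝒟`. [cite: MochizukiAbsTopIII2015, Corollary 3.6 (i) p.79] -/
theorem core5Diagram_eq_comapAlong : Δ.core5Diagram = Δ.diagram.comapAlong embCore5 :=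
  Δ.diagram.eq_comapAlong embCore5 (fun a => by rcases a with _ | _ <;> rfl)
    (fun a => by rcases a with _ | _ <;> exact HEq.rfl)
    (fun e => by
      rename_i a b
      revert e
      rcases a with ⟨_ | _ | _ | _ | _ | _, _⟩ | _ <;> rcases b with _ | _ <;> intro e <;>
        first | exact (PEmpty.elim e) | exact HEq.rfl)

/-- `𝒟_{≤5} ∪ {ℰ}` (`core6Diagram`) IS `embCore6^*𝒟`. [cite: MochizukiAbsTopIII2015, Corollary 3.6 (i) p.79] -/
theorem core6Diagram_eq_comapAlong : Δ.core6Diagram = Δ.diagram.comapAlong embCore6 :=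
  Δ.diagram.eq_comapAlong embCore6 (fun a => by rcases a with _ | _ <;> rfl)
    (fun a => by rcases a with _ | _ <;> exact HEq.rfl)
    (fun e => by
      rename_i a b
      revert e
      rcases a with ⟨_ | _ | _ | _ | _ | _, _⟩ | _ <;> rcases b with _ | _ <;> intro e <;>
        first | exact (PEmpty.elim e) | exact HEq.rfl)

/-- `𝒟_{≤3}` (`sub3`) IS the sub-diagram `embLogTele^*𝒟_An` of the telecore diagram.
[cite: MochizukiAbsTopIII2015, Corollary 3.6 (iii) p.80] -/
theorem sub3_eq_comapAlong_tele (J : SubVertex {a : LFVertex | a.row ≤ 4} → Type u)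
    (telMap : ∀ {a}, J a → (Δ.A ⥤ (Δ.sub 4).obj a)) :
    Δ.sub3 = (Δ.teleDiagram J telMap).comapAlong (embLogTele J) :=
  (Δ.teleDiagram J telMap).eq_comapAlong (embLogTele J) (fun a => by rcases a with _ | _ <;> rfl)
    (fun a => by rcases a with _ | _ <;> exact HEq.rfl)
    (fun e => by
      rename_i a b
      revert e
      rcases a with ⟨_ | _ | _ | _ | _ | _, _⟩ | _ <;> rcases b with _ | _ <;> intro e <;>
        first | exact (PEmpty.elim e) | exact HEq.rfl)

/-- **The pullback to `𝒟_{≤3}` of a family `K` on `𝒟`** (its restriction to the sub-diagram, typed on the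
presentation `sub3`). [cite: MochizukiAbsTopIII2015, Corollary 3.6 (iii) p.80] -/
noncomputable def pullLog (K : Δ.diagram.HomotopyFamily) : Δ.sub3.HomotopyFamily :=
  Δ.sub3_eq_comapAlong.symm ▸ K.comap embLog

/-- The boundary set of the pullback: the pairs whose images lie in `E_K`.
[cite: MochizukiAbsTopIII2015, Corollary 3.6 (iii) p.80] -/
theorem pullLog_E_iff (K : Δ.diagram.HomotopyFamily) {a b : logObsShape.{u}.Vertex} (p q : Path a b) :
    (Δ.pullLog K).E p q ↔ K.E (embLog.mapPath p) (embLog.mapPath q) :=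
  DiagramOfCategories.HomotopyFamily.cast_E_iff _ _ p q

/-- The pullback is compatible with `K` along `embLog` (Def. 3.5 (ii)).
[cite: MochizukiAbsTopIII2015, Corollary 3.6 (iii) p.80] -/
theorem pullLog_compatibleAlong (K : Δ.diagram.HomotopyFamily) : (Δ.pullLog K).CompatibleAlong embLog K :=
  fun _ _ p q hE => K.cast_comap_compatible embLog Δ.sub3_eq_comapAlong.symm p q hE

/-- **The pullback to `𝒟_{≤3} ∪ {ℰ}` of a family on `𝒟`.** [cite: MochizukiAbsTopIII2015, Corollary 3.6 (i) p.79] -/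
noncomputable def pullCore4 (K : Δ.diagram.HomotopyFamily) : Δ.core4Diagram.HomotopyFamily :=
  Δ.core4Diagram_eq_comapAlong.symm ▸ K.comap embCore4

/-- Its boundary set. [cite: MochizukiAbsTopIII2015, Corollary 3.6 (i) p.79] -/
theorem pullCore4_E_iff (K : Δ.diagram.HomotopyFamily) {a b : coreShape4.{u}.Vertex} (p q : Path a b) :
    (Δ.pullCore4 K).E p q ↔ K.E (embCore4.mapPath p) (embCore4.mapPath q) :=
  DiagramOfCategories.HomotopyFamily.cast_E_iff _ _ p q

/-- Its compatibility with `K`. [cite: MochizukiAbsTopIII2015, Corollary 3.6 (i) p.79] -/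
theorem pullCore4_compatibleAlong (K : Δ.diagram.HomotopyFamily) :
    (Δ.pullCore4 K).CompatibleAlong embCore4 K :=
  fun _ _ p q hE => K.cast_comap_compatible embCore4 Δ.core4Diagram_eq_comapAlong.symm p q hE

/-- **The pullback to `𝒟_{≤4} ∪ {Anab}` of a family on `𝒟`.** [cite: MochizukiAbsTopIII2015, Corollary 3.6 (i) p.79] -/
noncomputable def pullCore5 (K : Δ.diagram.HomotopyFamily) : Δ.core5Diagram.HomotopyFamily :=
  Δ.core5Diagram_eq_comapAlong.symm ▸ K.comap embCore5

/-- Its boundary set. [cite: MochizukiAbsTopIII2015, Corollary 3.6 (i) p.79] -/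
theorem pullCore5_E_iff (K : Δ.diagram.HomotopyFamily) {a b : coreShape5.{u}.Vertex} (p q : Path a b) :
    (Δ.pullCore5 K).E p q ↔ K.E (embCore5.mapPath p) (embCore5.mapPath q) :=
  DiagramOfCategories.HomotopyFamily.cast_E_iff _ _ p q

/-- Its compatibility with `K`. [cite: MochizukiAbsTopIII2015, Corollary 3.6 (i) p.79] -/
theorem pullCore5_compatibleAlong (K : Δ.diagram.HomotopyFamily) :
    (Δ.pullCore5 K).CompatibleAlong embCore5 K :=
  fun _ _ p q hE => K.cast_comap_compatible embCore5 Δ.core5Diagram_eq_comapAlong.symm p q hE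

/-- **The pullback to `𝒟_{≤5} ∪ {ℰ}` of a family on `𝒟`.** [cite: MochizukiAbsTopIII2015, Corollary 3.6 (i) p.79] -/
noncomputable def pullCore6 (K : Δ.diagram.HomotopyFamily) : Δ.core6Diagram.HomotopyFamily :=
  Δ.core6Diagram_eq_comapAlong.symm ▸ K.comap embCore6

/-- Its boundary set. [cite: MochizukiAbsTopIII2015, Corollary 3.6 (i) p.79] -/
theorem pullCore6_E_iff (K : Δ.diagram.HomotopyFamily) {a b : coreShape6.{u}.Vertex} (p q : Path a b) :
    (Δ.pullCore6 K).E p q ↔ K.E (embCore6.mapPath p) (embCore6.mapPath q) :=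
  DiagramOfCategories.HomotopyFamily.cast_E_iff _ _ p q

/-- Its compatibility with `K`. [cite: MochizukiAbsTopIII2015, Corollary 3.6 (i) p.79] -/
theorem pullCore6_compatibleAlong (K : Δ.diagram.HomotopyFamily) :
    (Δ.pullCore6 K).CompatibleAlong embCore6 K :=
  fun _ _ p q hE => K.cast_comap_compatible embCore6 Δ.core6Diagram_eq_comapAlong.symm p q hE

/-- **The pullback to `𝒟_{≤3}` of a family on the telecore diagram `𝒟_An`.**
[cite: MochizukiAbsTopIII2015, Corollary 3.6 (iii) p.80] -/
noncomputable def pullLogTele {J : SubVertex {a : LFVertex | a.row ≤ 4} → Type u}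
    {telMap : ∀ {a}, J a → (Δ.A ⥤ (Δ.sub 4).obj a)}
    (K : (Δ.teleDiagram J telMap).HomotopyFamily) : Δ.sub3.HomotopyFamily :=
  (Δ.sub3_eq_comapAlong_tele J telMap).symm ▸ K.comap (embLogTele J)

/-- Its compatibility with `K` along `𝒟_{≤3} ↪ 𝒟_An`. [cite: MochizukiAbsTopIII2015, Corollary 3.6 (iii) p.80] -/
theorem pullLogTele_compatibleAlong {J : SubVertex {a : LFVertex | a.row ≤ 4} → Type u}
    {telMap : ∀ {a}, J a → (Δ.A ⥤ (Δ.sub 4).obj a)}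
    (K : (Δ.teleDiagram J telMap).HomotopyFamily) :
    (Δ.pullLogTele K).CompatibleAlong (embLogTele J) K :=
  fun _ _ p q hE => K.cast_comap_compatible (embLogTele J) (Δ.sub3_eq_comapAlong_tele J telMap).symm p q hE

/-! ### The literal statements reduce to ONE family on `𝒟` -/

/-- The core vertex `ℰ` of `𝒟_{≤3} ∪ {ℰ}` has no outgoing edges. [cite: MochizukiAbsTopIII2015, Corollary 3.6 (i) p.79] -/
theorem isEmpty_hom_obs4 (b : coreShape4.{u}.Vertex) : IsEmpty (coreShape4.{u}.obs ⟶ b) := by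
  rcases b with _ | _ <;> exact ⟨fun e => PEmpty.elim e⟩

/-- The core vertex `Anab` of `𝒟_{≤4} ∪ {Anab}` has no outgoing edges. [cite: MochizukiAbsTopIII2015, Corollary 3.6 (i) p.79] -/
theorem isEmpty_hom_obs5 (b : coreShape5.{u}.Vertex) : IsEmpty (coreShape5.{u}.obs ⟶ b) := by
  rcases b with _ | _ <;> exact ⟨fun e => PEmpty.elim e⟩

/-- The core vertex `ℰ` of `𝒟_{≤5} ∪ {ℰ}` has no outgoing edges. [cite: MochizukiAbsTopIII2015, Corollary 3.6 (i) p.79] -/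
theorem isEmpty_hom_obs6 (b : coreShape6.{u}.Vertex) : IsEmpty (coreShape6.{u}.obs ⟶ b) := by
  rcases b with _ | _ <;> exact ⟨fun e => PEmpty.elim e⟩

/-- The candidate core family on `𝒟_{≤3} ∪ {ℰ}` cut out of a family `K` on `𝒟`: the pulled-back pairs
ending at `ℰ`. [cite: MochizukiAbsTopIII2015, Corollary 3.6 (i) p.79] -/
noncomputable def coreFamily4Of (K : Δ.diagram.HomotopyFamily) : Δ.core4Diagram.HomotopyFamily :=
  (Δ.pullCore4 K).endingAt coreShape4.{u}.obs isEmpty_hom_obs4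

/-- … on `𝒟_{≤4} ∪ {Anab}`. [cite: MochizukiAbsTopIII2015, Corollary 3.6 (i) p.79] -/
noncomputable def coreFamily5Of (K : Δ.diagram.HomotopyFamily) : Δ.core5Diagram.HomotopyFamily :=
  (Δ.pullCore5 K).endingAt coreShape5.{u}.obs isEmpty_hom_obs5

/-- … on `𝒟_{≤5} ∪ {ℰ}`. [cite: MochizukiAbsTopIII2015, Corollary 3.6 (i) p.79] -/
noncomputable def coreFamily6Of (K : Δ.diagram.HomotopyFamily) : Δ.core6Diagram.HomotopyFamily :=
  (Δ.pullCore6 K).endingAt coreShape6.{u}.obs isEmpty_hom_obs6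

/-- **Reduction of Cor. 3.6 (iii), second clause (cores), to ONE family on `𝒟`**: if the pullback of
`K` to `𝒟_{≤3}` is the `𝔖_log` family and, for `n = 4, 5, 6`, the pulled-back pairs ending at the core
vertex make `(𝒟_{≤n}, core)` a core (i.e. `K` contains ALL co-verticial pairs into the row-`n`
vertex, with coherent homotopies), then `K` realises the cores and `𝔖_log`.
[cite: MochizukiAbsTopIII2015, Corollary 3.6 (iii) p.80] -/
theorem realisesCoresAndLogObs_of_pull (K : Δ.diagram.HomotopyFamily)
    (h₃ : Δ.IsLogObservableFamily (Δ.pullLog K))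
    (h₄ : (Δ.coreObs4 (Δ.coreFamily4Of K) (fun _ _ _ _ h => h.1)).IsCore)
    (h₅ : (Δ.coreObs5 (Δ.coreFamily5Of K) (fun _ _ _ _ h => h.1)).IsCore)
    (h₆ : (Δ.coreObs6 (Δ.coreFamily6Of K) (fun _ _ _ _ h => h.1)).IsCore) :
    Δ.RealisesCoresAndLogObs K :=
  ⟨⟨_, h₃, Δ.pullLog_compatibleAlong K⟩,
    ⟨_, _, h₄, HomotopyFamily.endingAt_compatibleAlong _ _ _ (Δ.pullCore4_compatibleAlong K) _ _⟩,
    ⟨_, _, h₅, HomotopyFamily.endingAt_compatibleAlong _ _ _ (Δ.pullCore5_compatibleAlong K) _ _⟩,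
    ⟨_, _, h₆, HomotopyFamily.endingAt_compatibleAlong _ _ _ (Δ.pullCore6_compatibleAlong K) _ _⟩⟩

/-- **The discharge target of `LogObsCompatCoresStmt`**: ONE family of homotopies `K` on `𝒟` whose
restriction to `𝒟_{≤3}` is the `𝔖_log` family and which, for `n = 4, 5, 6`, makes `(𝒟_{≤n}, core vertex)`
a core on the pairs ending there. [cite: MochizukiAbsTopIII2015, Corollary 3.6 (iii) p.80] -/
theorem logObsCompatCoresStmt_of_pull (K : Δ.diagram.HomotopyFamily)
    (h₃ : Δ.IsLogObservableFamily (Δ.pullLog K))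
    (h₄ : (Δ.coreObs4 (Δ.coreFamily4Of K) (fun _ _ _ _ h => h.1)).IsCore)
    (h₅ : (Δ.coreObs5 (Δ.coreFamily5Of K) (fun _ _ _ _ h => h.1)).IsCore)
    (h₆ : (Δ.coreObs6 (Δ.coreFamily6Of K) (fun _ _ _ _ h => h.1)).IsCore) : Δ.LogObsCompatCoresStmt :=
  ⟨K, Δ.realisesCoresAndLogObs_of_pull K h₃ h₄ h₅ h₆⟩

/-- The identity 1-morphism of `𝒟` has identity 2-cells (bookkeeping, as in `FrobeniusPictureMLFShift`).
[folklore] -/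
private theorem id_iso_app' : ∀ ⦃a b : LFVertex⦄ (e : a ⟶ b) (x : Δ.diagram.obj a),
    ∃ h, ((OneMorphism.id Δ.diagram).iso e).hom.app x = eqToHom h := by
  intro a b e x
  exact ⟨rfl, by
    simp only [OneMorphism.id, Iso.trans_hom, Iso.symm_hom, NatTrans.comp_app,
      Functor.leftUnitor_hom_app, Functor.rightUnitor_inv_app]
    erw [Category.comp_id]
    rfl⟩

/-- **The `ℤ`-action of (v) IS gen-0's shift** (`shiftEquiv`: translation of the first row by `m`,
identity elsewhere): `IsShiftAction Δ.shiftEquiv` — the witness inside the proof of `shiftStmt`, exposed.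
[cite: MochizukiAbsTopIII2015, Corollary 3.6 (v) p.80] -/
theorem isShiftAction_shiftEquiv : Δ.IsShiftAction Δ.shiftEquiv := by
  refine ⟨Δ.shiftEquiv_isNexusClass, fun m n => rfl, ⟨LFVertex.shift_zero, ?_⟩,
    fun m m' => ⟨LFVertex.shift_comp m m', ?_⟩⟩
  · exact OneMorphism.isomorphic_transport _ _ _ (Δ.shiftApp_heq_id 0) (Δ.shiftMor_iso_app 0)
      Δ.id_iso_app'
  · exact OneMorphism.isomorphic_transport _ _ _ (Δ.shiftMor_comp_app_heq m m')
      (Δ.shiftMor_comp_iso_app m m') (Δ.shiftMor_iso_app (m + m'))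

/-- **The discharge target of `ShiftCompatStmt`** (Cor. 3.6 (v), third sentence): ONE family `K` on `𝒟`
realising the cores and `𝔖_log` such that every shift `shiftEquiv m` is compatible with `K` in the
sense of Def. 3.5 (v). [cite: MochizukiAbsTopIII2015, Corollary 3.6 (v) p.80] -/
theorem shiftCompatStmt_of (K : Δ.diagram.HomotopyFamily) (hK : Δ.RealisesCoresAndLogObs K)
    (hc : ∀ m : ℤ, Nonempty ((Δ.shiftEquiv m).hom.CompatibleWith K K)) : Δ.ShiftCompatStmt :=
  ⟨Δ.shiftEquiv, K, Δ.isShiftAction_shiftEquiv, hK, hc⟩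

end LogFrobeniusData

end Literature.AnabelianGeometry.AbsoluteAnabelian
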